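import Summits.KontsevichZagierPeriods.KontsevichZagierPeriods.Theorems.K2SymbolChainsClausenPiVanishesBandRep
import Summits.KontsevichZagierPeriods.KontsevichZagierPeriods.Theorems.K2SymbolChainsClausenPiVanishesAtoms

/-!
# The two sheets of item ClausenPiVanishes as bands

Route item ClausenPiVanishes (stmt-KontsevichZagierPeriods-5202) of route
KontsevichZagierPeriods/K2SymbolChains. The item's representations
`r = [{1 < u < V(t)}, 1/((1+t²)u)]`, `r' = [{V(t) < u < 1}, 1/((1+t²)u)]` (`V = 4t²/(1+t²)`) are
carried by the fibrewise dilation `u ↦ A(t)·u`, `A = (1+t²)/t² = 4/V` (rule 2),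
`KZ.of_sub_of_mem_relations_of_affine`) onto the bands `X = [{1 ≤ 3t²} × [A, 4], h/u]`
(`pos_part`) and `Y = [{t ≠ 0, 3t² < 1} × [4, A], h/u]` (`neg_part`), null pieces being relations;
and `[band σ 1 4] − [band σ 1 A] ∼ [X] − [Y]` by domain additivity (`exists_X_Y`). Sources:
M. Kontsevich, D. Zagier, *Periods* (2001), §1.2, rules 1)–2). [folklore]
-/

noncomputable section

open MeasureTheory Set Filter MvPolynomial
open Literature.ModelTheory.ExponentialFields (IsSemialgebraic tarski_seidenberg_real_holds
  isSemialgebraic_setOf_eval_lt isSemialgebraic_setOf_eval_le isSemialgebraic_setOf_eval_ne_zero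
  isSemialgebraic_setOf_eval_eq_zero isSemialgebraic_univ)
open Literature.NumberTheory.Transcendental
open Literature.NumberTheory.Transcendental.KZ

namespace Summit.KontsevichZagierPeriods.K2SymbolChains.ClausenPi

/-! ### Null sets in `ℝ¹` and `ℝ²` -/

/-- `{3t² = 1} ⊆ ℝ¹` is null (two points). [folklore] -/
theorem volume_setOf_three_sq_eq_one : volume {x : Fin 1 → ℝ | 3 * x 0 ^ 2 = (1 : ℝ)} = 0 := by
  set c : ℝ := Real.sqrt (1 / 3) with hc
  have hc2 : c ^ 2 = 1 / 3 := Real.sq_sqrt (by norm_num)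
  refine measure_mono_null (fun x hx => ?_)
    (measure_union_null (volume_setOf_last_eq_zero (n := 0) c)
      (volume_setOf_last_eq_zero (n := 0) (-c)))
  have hx' : x 0 ^ 2 = c ^ 2 := by
    have : 3 * x 0 ^ 2 = (1 : ℝ) := hx
    rw [hc2]
    linarith
  exact sq_eq_sq_iff_eq_or_eq_neg.1 hx'

/-- The coordinate hyperplane `{w 0 = 0} ⊆ ℝ²` is null. [folklore] -/
theorem volume_setOf_apply_zero_eq_zero : volume {w : Fin 2 → ℝ | w 0 = 0} = 0 := by
  rw [volume_pi]
  exact Measure.pi_hyperplane _ 0 _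

/-! ### The positive part: `[{1 < u < V}, h/u] ∼ [band {1 ≤ 3t²} A 4, h/u]` -/

/-- **The positive sheet.** The representation `r = [{1 < u < V(t)}, 1/((1+t²)u)]` of item
ClausenPiVanishes (`V = 4t²/(1+t²)`) and the band `[{1 ≤ 3t², A(t) ≤ u ≤ 4}, h(t)/u]`
(`A = (1+t²)/t² = 4/V`) differ by a relation: over the open base `{1 < 3t²}` this is the dilation
`u ↦ A(t) u` (rule 2), `KZ.of_sub_of_mem_relations_of_affine`, `A·V = 4`); the rest (fibres over
`3t² = 1`, the edges `u = 1`, `u = V`) is null. [Kontsevich–Zagier 2001, §1.2, rules 1)–2)]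
[folklore] -/
theorem pos_part (r X : KZ.IntegralRep 2)
    (hr : r.domain = {w | 1 < w 1 ∧ w 1 < 4 * w 0 ^ 2 / (1 + w 0 ^ 2)})
    (hri : EqOn r.integrand (fun w => 1 / ((1 + w 0 ^ 2) * w 1)) r.domain)
    (hXd : X.domain = KZlog.band {x : Fin 1 → ℝ | (1 : ℝ) ≤ 3 * x 0 ^ 2}
      (fun x => (1 + x 0 ^ 2) / x 0 ^ 2) (fun _ => 4))
    (hXi : X.integrand = fun z => 1 / (1 + Fin.init z 0 ^ 2) / z (Fin.last 1)) :
    KZ.of X - KZ.of r ∈ KZ.relations := by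
  -- the base sets
  set G : Set (Fin 1 → ℝ) := {x | (1 : ℝ) < 3 * x 0 ^ 2} with hG
  have hGs : IsSemialgebraic ℚ G := isSemialgebraic_one_lt_three_sq
  have hGo : IsOpen G := isOpen_lt continuous_const (by fun_prop)
  have hG0 : ∀ x ∈ G, x 0 ≠ 0 := fun x hx h0 => by
    have : (1 : ℝ) < 3 * x 0 ^ 2 := hx
    rw [h0] at this
    norm_num at this
  have hLs : IsSemialgebraic ℚ {x : Fin 1 → ℝ | (1 : ℝ) ≤ 3 * x 0 ^ 2} :=
    isSemialgebraic_one_le_three_sq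
  have hL0 : ∀ x ∈ {x : Fin 1 → ℝ | (1 : ℝ) ≤ 3 * x 0 ^ 2}, x 0 ≠ 0 := fun x hx h0 => by
    have : (1 : ℝ) ≤ 3 * x 0 ^ 2 := hx
    rw [h0] at this
    norm_num at this
  set N : Set (Fin 1 → ℝ) := {x : Fin 1 → ℝ | (1 : ℝ) ≤ 3 * x 0 ^ 2} \ G with hN
  have hNs : IsSemialgebraic ℚ N := hLs.diff hGs
  have hN0 : volume N = 0 := by
    refine measure_mono_null (fun x hx => ?_) volume_setOf_three_sq_eq_one
    have h1 : (1 : ℝ) ≤ 3 * x 0 ^ 2 := hx.1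
    have h2 : ¬ (1 : ℝ) < 3 * x 0 ^ 2 := hx.2
    show 3 * x 0 ^ 2 = (1 : ℝ)
    linarith [not_lt.1 h2]
  have hGL : G ⊆ {x : Fin 1 → ℝ | (1 : ℝ) ≤ 3 * x 0 ^ 2} := fun x hx => le_of_lt (show (1:ℝ) < _ from hx)
  have hdec : {x : Fin 1 → ℝ | (1 : ℝ) ≤ 3 * x 0 ^ 2} = G ∪ N := (union_sdiff_cancel hGL).symm
  have hdisj : G ∩ N = ∅ := inter_sdiff_self G _
  -- split `X` over `G ∪ N`
  obtain ⟨XG, XN, hXGd, hXGi, hXNd, -, hsplit⟩ := exists_split_band X hXd hdec hdisj hGs hNs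
    (isSemialgebraicFunOn_A hLs hL0) (isSemialgebraicFunOn_four hLs)
  have hJ : KZ.of XN ∈ KZ.relations :=
    of_mem_relations_of_volume_eq_zero _ (measure_mono_null
      (hXNd ▸ band_subset_setOf_init_mem) (volume_setOf_init_mem_eq_zero hN0))
  -- the band `R₀ = [{t ∈ G, 1 ≤ u ≤ V}, h/u]`
  have hV1 : ∀ x ∈ G, (1 : ℝ) ≤ 4 * x 0 ^ 2 / (1 + x 0 ^ 2) := fun x hx => by
    have : (1 : ℝ) < 3 * x 0 ^ 2 := hx
    rw [le_div_iff₀ (by positivity)]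
    linarith
  have hiV : IntegrableOn (fun x : Fin 1 → ℝ => 1 / (1 + x 0 ^ 2) *
      Real.log (4 * x 0 ^ 2 / (1 + x 0 ^ 2) / 1)) G := by
    simpa only [div_one] using integrable_h_mul_log_V.integrableOn
  obtain ⟨R₀, hR₀d, hR₀i⟩ := exists_bandRep (g := fun x : Fin 1 → ℝ => 1 / (1 + x 0 ^ 2)) hGs
    (isSemialgebraicFunOn_one hGs) (isSemialgebraicFunOn_V hGs) (isSemialgebraicFunOn_h hGs)
    (fun _ _ => one_pos) hV1 hiV
  -- the dilation `u ↦ A u`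
  have hAd : DifferentiableOn ℝ (fun x : Fin 1 → ℝ => (1 + x 0 ^ 2) / x 0 ^ 2) G := by
    intro x hx
    have hx' : x 0 ≠ 0 := hG0 x hx
    fun_prop (disch := simpa using hx')
  have haff : KZ.of R₀ - KZ.of XG ∈ KZ.relations := by
    refine of_sub_of_mem_relations_of_affine hGo (α := fun _ => 0)
      (β := fun x => (1 + x 0 ^ 2) / x 0 ^ 2)
      (by simpa using isSemialgebraicFunOn_ratCast hGs 0) (isSemialgebraicFunOn_A hGs hG0)
      (differentiableOn_const _) hAd (fun x hx => by have := hG0 x hx; positivity) R₀ XG hR₀d hXGd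
      (fun y _ => by ring) (fun y hy => ?_) fun z hz => ?_
    · have := hG0 y hy
      field_simp
      ring
    · have hz' := hz
      rw [hR₀d] at hz'
      have ht : Fin.init z 0 ≠ 0 := hG0 _ hz'.1
      have hu : z (Fin.last 1) ≠ 0 := (one_pos.trans_le hz'.2.1).ne'
      rw [hR₀i, hXGi, hXi]
      simp only [Fin.init_snoc, Fin.snoc_last, zero_add]
      field_simp
  -- `r` inside `R₀`, up to a null set
  have hsub : r.domain ⊆ R₀.domain := by
    intro w hw
    rw [hr] at hw
    rw [hR₀d]
    have hw1 : (1 : ℝ) < 4 * w 0 ^ 2 / (1 + w 0 ^ 2) := hw.1.trans hw.2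
    refine ⟨?_, ?_, ?_⟩
    · show (1 : ℝ) < 3 * w 0 ^ 2
      rw [lt_div_iff₀ (by positivity)] at hw1
      linarith
    · simpa [Fin.init, show (Fin.last 1 : Fin 2) = 1 from rfl] using hw.1.le
    · simpa [Fin.init, show (Fin.last 1 : Fin 2) = 1 from rfl] using hw.2.le
  have hnull : volume (R₀.domain \ r.domain) = 0 := by
    refine measure_mono_null (fun w hw => ?_) (measure_union_null (volume_setOf_last_eq_zero (n := 1) 1)
      (volume_graph_eq_zero (isSemialgebraicFunOn_V hGs)))
    rw [hR₀d, hr] at hw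
    obtain ⟨⟨hG', h1, h2⟩, hn⟩ := hw
    simp only [mem_setOf_eq, not_and, not_lt] at hn
    simp only [mem_union, mem_setOf_eq]
    rcases h1.lt_or_eq with h1 | h1
    · right
      refine ⟨hG', le_antisymm h2 ?_⟩
      simpa [Fin.init, show (Fin.last 1 : Fin 2) = 1 from rfl] using hn (by simpa [Fin.init, show (Fin.last 1 : Fin 2) = 1 from rfl] using h1)
    · exact Or.inl h1.symm
  have hT1 : KZ.of R₀ - KZ.of r ∈ KZ.relations := by
    refine of_sub_of_mem_relations_of_subset_null R₀ r hsub hnull fun w hw => ?_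
    rw [hri hw, hR₀i]
    simp only [Fin.init, Fin.castSucc_zero, show (Fin.last 1 : Fin 2) = 1 from rfl, div_div]
  have : KZ.of X - KZ.of r = (KZ.of X - KZ.of XG - KZ.of XN) + KZ.of XN - (KZ.of R₀ - KZ.of XG)
      + (KZ.of R₀ - KZ.of r) := by abel
  rw [this]
  exact KZ.relations.add_mem (KZ.relations.sub_mem (KZ.relations.add_mem hsplit hJ) haff) hT1

/-! ### The negative part: `[{V < u < 1}, h/u] ∼ [band {0<3t²<1, t≠0} 4 A, h/u]` -/

/-- `{w 0 ≠ 0} ⊆ ℝ²` is `ℚ`-semialgebraic. [BCR 1998, §2.1] [folklore] -/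
theorem isSemialgebraic_fin_two_ne_zero : IsSemialgebraic ℚ {w : Fin 2 → ℝ | w 0 ≠ 0} := by
  have h := isSemialgebraic_setOf_eval_ne_zero (k := ℚ) (R := ℝ) (X 0 : MvPolynomial (Fin 2) ℚ)
  simp only [aeval_X] at h
  exact h

/-- **The negative sheet.** The representation `r' = [{V(t) < u < 1}, 1/((1+t²)u)]` of item
ClausenPiVanishes and the band `[{t ≠ 0, 3t² < 1, 4 ≤ u ≤ A(t)}, h(t)/u]` differ by a relation:
discard the null fibre over `t = 0` and the null edges, then dilate `u ↦ A(t) u` over the open base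
`{t ≠ 0, 3t² < 1}` (`A·V = 4`, `A·1 = A`; rule 2)). [Kontsevich–Zagier 2001, §1.2, rules 1)–2)]
[folklore] -/
theorem neg_part (r' Y : KZ.IntegralRep 2)
    (hr' : r'.domain = {w | 4 * w 0 ^ 2 / (1 + w 0 ^ 2) < w 1 ∧ w 1 < 1})
    (hri' : EqOn r'.integrand (fun w => 1 / ((1 + w 0 ^ 2) * w 1)) r'.domain)
    (hYd : Y.domain = KZlog.band {x : Fin 1 → ℝ | x 0 ≠ 0 ∧ 3 * x 0 ^ 2 < (1 : ℝ)} (fun _ => 4)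
      (fun x => (1 + x 0 ^ 2) / x 0 ^ 2))
    (hYi : Y.integrand = fun z => 1 / (1 + Fin.init z 0 ^ 2) / z (Fin.last 1)) :
    KZ.of Y - KZ.of r' ∈ KZ.relations := by
  set G : Set (Fin 1 → ℝ) := {x | x 0 ≠ 0 ∧ 3 * x 0 ^ 2 < (1 : ℝ)} with hG
  have hGs : IsSemialgebraic ℚ G := isSemialgebraic_ne_zero.inter isSemialgebraic_three_sq_lt_one
  have hGo : IsOpen G := by
    have h1 : IsOpen {x : Fin 1 → ℝ | x 0 ≠ 0} := isOpen_ne_fun (continuous_apply 0) continuous_const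
    have h2 : IsOpen {x : Fin 1 → ℝ | 3 * x 0 ^ 2 < (1 : ℝ)} :=
      isOpen_lt (f := fun x : Fin 1 → ℝ => 3 * x 0 ^ 2) (g := fun _ => (1 : ℝ)) (by fun_prop)
        continuous_const
    exact h1.inter h2
  have hG0 : ∀ x ∈ G, x 0 ≠ 0 := fun x hx => hx.1
  -- the band `R₀ = [{t ∈ G, V ≤ u ≤ 1}, h/u]`
  have hV0 : ∀ x ∈ G, (0 : ℝ) < 4 * x 0 ^ 2 / (1 + x 0 ^ 2) := fun x hx => by
    have := hx.1
    positivity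
  have hV1 : ∀ x ∈ G, 4 * x 0 ^ 2 / (1 + x 0 ^ 2) ≤ (1 : ℝ) := fun x hx => by
    have : 3 * x 0 ^ 2 < (1 : ℝ) := hx.2
    rw [div_le_one (by positivity)]
    linarith
  have hiV : IntegrableOn (fun x : Fin 1 → ℝ => 1 / (1 + x 0 ^ 2) *
      Real.log (1 / (4 * x 0 ^ 2 / (1 + x 0 ^ 2)))) G := by
    refine (integrable_h_mul_log_V.neg.integrableOn).congr_fun (fun x _ => ?_)
      (IsSemialgebraic.measurableSet_holds hGs)
    simp only [Pi.neg_apply]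
    rw [one_div (4 * x 0 ^ 2 / (1 + x 0 ^ 2)), Real.log_inv, mul_neg]
  obtain ⟨R₀, hR₀d, hR₀i⟩ := exists_bandRep (g := fun x : Fin 1 → ℝ => 1 / (1 + x 0 ^ 2)) hGs
    (isSemialgebraicFunOn_V hGs) (isSemialgebraicFunOn_one hGs) (isSemialgebraicFunOn_h hGs) hV0 hV1 hiV
  -- the dilation `u ↦ A u`
  have hAd : DifferentiableOn ℝ (fun x : Fin 1 → ℝ => (1 + x 0 ^ 2) / x 0 ^ 2) G := by
    intro x hx
    have hx' : x 0 ≠ 0 := hG0 x hx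
    fun_prop (disch := simpa using hx')
  have haff : KZ.of R₀ - KZ.of Y ∈ KZ.relations := by
    refine of_sub_of_mem_relations_of_affine hGo (α := fun _ => 0)
      (β := fun x => (1 + x 0 ^ 2) / x 0 ^ 2)
      (by simpa using isSemialgebraicFunOn_ratCast hGs 0) (isSemialgebraicFunOn_A hGs hG0)
      (differentiableOn_const _) hAd (fun x hx => by have := hG0 x hx; positivity) R₀ Y hR₀d hYd
      (fun y hy => ?_) (fun y _ => by ring) fun z hz => ?_
    · have := hG0 y hy
      field_simp
      ring
    · have hz' := hz
      rw [hR₀d] at hz'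
      have ht : Fin.init z 0 ≠ 0 := hG0 _ hz'.1
      have hu : z (Fin.last 1) ≠ 0 := ((hV0 _ hz'.1).trans_le hz'.2.1).ne'
      rw [hR₀i, hYi]
      simp only [Fin.init_snoc, Fin.snoc_last, zero_add]
      field_simp
  -- `r'` minus the fibre over `t = 0`
  have hOs : IsSemialgebraic ℚ (r'.domain ∩ {w : Fin 2 → ℝ | w 0 ≠ 0}) :=
    r'.isSemialgebraic_domain.inter isSemialgebraic_fin_two_ne_zero
  set r'' := r'.restrict _ hOs inter_subset_left with hr''
  have hT6 : KZ.of r' - KZ.of r'' ∈ KZ.relations := by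
    refine of_sub_of_mem_relations_of_subset_null r' r'' inter_subset_left
      (measure_mono_null (fun w hw => ?_) volume_setOf_apply_zero_eq_zero) fun _ _ => rfl
    rw [hr'', IntegralRep.domain_restrict] at hw
    by_contra h0
    exact hw.2 ⟨hw.1, h0⟩
  -- `r''` inside `R₀`, up to a null set
  have hsub : r''.domain ⊆ R₀.domain := by
    intro w hw
    rw [hr'', IntegralRep.domain_restrict, hr'] at hw
    obtain ⟨⟨h1, h2⟩, h0⟩ := hw
    rw [hR₀d]
    have hV1' : 4 * w 0 ^ 2 / (1 + w 0 ^ 2) < (1 : ℝ) := h1.trans h2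
    refine ⟨⟨?_, ?_⟩, ?_, ?_⟩
    · exact h0
    · show 3 * w 0 ^ 2 < (1 : ℝ)
      rw [div_lt_iff₀ (by positivity)] at hV1'
      linarith
    · simpa [Fin.init, show (Fin.last 1 : Fin 2) = 1 from rfl] using h1.le
    · simpa [Fin.init, show (Fin.last 1 : Fin 2) = 1 from rfl] using h2.le
  have hnull : volume (R₀.domain \ r''.domain) = 0 := by
    refine measure_mono_null (fun w hw => ?_) (measure_union_null (volume_setOf_last_eq_zero (n := 1) 1)
      (volume_graph_eq_zero (isSemialgebraicFunOn_V hGs)))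
    rw [hR₀d, hr'', IntegralRep.domain_restrict, hr'] at hw
    obtain ⟨⟨hG', h1, h2⟩, hn⟩ := hw
    have h0 : w 0 ≠ 0 := hG'.1
    simp only [mem_inter_iff, mem_setOf_eq, not_and] at hn
    simp only [mem_union, mem_setOf_eq]
    rcases h2.lt_or_eq with h2 | h2
    · right
      refine ⟨hG', le_antisymm ?_ h1⟩
      have h1' : 4 * w 0 ^ 2 / (1 + w 0 ^ 2) ≤ w 1 := by simpa [Fin.init, show (Fin.last 1 : Fin 2) = 1 from rfl] using h1
      rcases h1'.lt_or_eq with h1' | h1'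
      · exact (hn ⟨h1', by simpa [Fin.init, show (Fin.last 1 : Fin 2) = 1 from rfl] using h2⟩ h0).elim
      · simpa [Fin.init, show (Fin.last 1 : Fin 2) = 1 from rfl] using h1'.symm.le
    · exact Or.inl h2
  have hT5 : KZ.of R₀ - KZ.of r'' ∈ KZ.relations := by
    refine of_sub_of_mem_relations_of_subset_null R₀ r'' hsub hnull fun w hw => ?_
    have hw' : w ∈ r'.domain := by
      rw [hr'', IntegralRep.domain_restrict] at hw
      exact hw.1
    rw [hr'', IntegralRep.integrand_restrict, hri' hw', hR₀i]
    simp only [Fin.init, Fin.castSucc_zero, show (Fin.last 1 : Fin 2) = 1 from rfl, div_div]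
  have : KZ.of Y - KZ.of r' = -(KZ.of R₀ - KZ.of Y) + (KZ.of R₀ - KZ.of r'') - (KZ.of r' - KZ.of r'') := by
    abel
  rw [this]
  exact KZ.relations.sub_mem (KZ.relations.add_mem (KZ.relations.neg_mem haff) hT5) hT6

/-! ### From `log 4 − log A` to the two sheets -/

/-- **Splitting `L(4) − L(A)` into the two sheets.** For the bands `e = [band σ 1 4, h/u]` and
`a = [band σ 1 A, h/u]`: splitting the base at `3t² = 1` and each band along `u` at `A`, resp. `4`
(domain additivity, rule 1a)), `[e] − [a] ∼ [X] − [Y]` with `X = [band {1 ≤ 3t²} A 4, h/u]` and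
`Y = [band {t ≠ 0, 3t² < 1} 4 A, h/u]`. [Kontsevich–Zagier 2001, §1.2, rule 1)] [folklore] -/
theorem exists_X_Y (e a : KZ.IntegralRep 2)
    (hed : e.domain = KZlog.band {x : Fin 1 → ℝ | x 0 ≠ 0} (fun _ => 1) (fun _ => 4))
    (hei : e.integrand = fun z => 1 / (1 + Fin.init z 0 ^ 2) / z (Fin.last 1))
    (had : a.domain = KZlog.band {x : Fin 1 → ℝ | x 0 ≠ 0} (fun _ => 1)
      (fun x => (1 + x 0 ^ 2) / x 0 ^ 2))
    (hai : a.integrand = fun z => 1 / (1 + Fin.init z 0 ^ 2) / z (Fin.last 1)) :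
    ∃ X Y : KZ.IntegralRep 2,
      X.domain = KZlog.band {x : Fin 1 → ℝ | (1 : ℝ) ≤ 3 * x 0 ^ 2}
        (fun x => (1 + x 0 ^ 2) / x 0 ^ 2) (fun _ => 4) ∧
      X.integrand = (fun z => 1 / (1 + Fin.init z 0 ^ 2) / z (Fin.last 1)) ∧
      Y.domain = KZlog.band {x : Fin 1 → ℝ | x 0 ≠ 0 ∧ 3 * x 0 ^ 2 < (1 : ℝ)} (fun _ => 4)
        (fun x => (1 + x 0 ^ 2) / x 0 ^ 2) ∧
      Y.integrand = (fun z => 1 / (1 + Fin.init z 0 ^ 2) / z (Fin.last 1)) ∧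
      KZ.of e - KZ.of a - (KZ.of X - KZ.of Y) ∈ KZ.relations := by
  have hσ := isSemialgebraic_ne_zero
  have hLs : IsSemialgebraic ℚ {x : Fin 1 → ℝ | (1 : ℝ) ≤ 3 * x 0 ^ 2} :=
    isSemialgebraic_one_le_three_sq
  have hGs : IsSemialgebraic ℚ {x : Fin 1 → ℝ | x 0 ≠ 0 ∧ 3 * x 0 ^ 2 < (1 : ℝ)} :=
    isSemialgebraic_ne_zero.inter isSemialgebraic_three_sq_lt_one
  have hL0 : ∀ x ∈ {x : Fin 1 → ℝ | (1 : ℝ) ≤ 3 * x 0 ^ 2}, x 0 ≠ 0 := fun x hx h0 => by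
    have : (1 : ℝ) ≤ 3 * x 0 ^ 2 := hx
    rw [h0] at this
    norm_num at this
  have hdec : {x : Fin 1 → ℝ | x 0 ≠ 0} =
      {x | (1 : ℝ) ≤ 3 * x 0 ^ 2} ∪ {x | x 0 ≠ 0 ∧ 3 * x 0 ^ 2 < (1 : ℝ)} := by
    ext x
    simp only [mem_setOf_eq, mem_union]
    constructor
    · intro hx
      rcases le_or_gt (1 : ℝ) (3 * x 0 ^ 2) with h | h
      · exact Or.inl h
      · exact Or.inr ⟨hx, h⟩
    · rintro (hx | hx)
      · exact hL0 x hx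
      · exact hx.1
  have hdisj : {x : Fin 1 → ℝ | (1 : ℝ) ≤ 3 * x 0 ^ 2} ∩ {x | x 0 ≠ 0 ∧ 3 * x 0 ^ 2 < (1 : ℝ)} = ∅ := by
    ext x
    simp only [mem_inter_iff, mem_setOf_eq, mem_empty_iff_false, iff_false, not_and, not_lt]
    exact fun h _ => h
  obtain ⟨eL, eG, heLd, heLi, heGd, heGi, hse⟩ := exists_split_band e hed hdec hdisj hLs hGs
    (isSemialgebraicFunOn_one hσ) (isSemialgebraicFunOn_four hσ)
  obtain ⟨aL, aG, haLd, haLi, haGd, haGi, hsa⟩ := exists_split_band a had hdec hdisj hLs hGs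
    (isSemialgebraicFunOn_one hσ) (isSemialgebraicFunOn_A hσ fun _ hx => hx)
  -- on `{1 ≤ 3t²}`: `1 ≤ A ≤ 4`, split `eL` at `u = A`
  obtain ⟨aL', X, haL'd, haL'i, hXd, hXi, hs1⟩ := exists_split_last eL heLd hLs
    (isSemialgebraicFunOn_one hLs) (isSemialgebraicFunOn_four hLs) (isSemialgebraicFunOn_A hLs hL0)
    (fun x hx => by
      have h0 := hL0 x hx
      rw [le_div_iff₀ (by positivity)]
      linarith) (fun x hx => by
      have h : (1 : ℝ) ≤ 3 * x 0 ^ 2 := hx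
      have h0 := hL0 x hx
      rw [div_le_iff₀ (by positivity)]
      linarith)
  have h1 : KZ.of aL' - KZ.of aL ∈ KZ.relations :=
    of_sub_of_mem_relations_of_eqOn (by rw [haLd, haL'd]) fun z _ => by
      rw [haL'i, heLi, hei, haLi, hai]
  -- on `{t ≠ 0, 3t² < 1}`: `4 ≤ A`, split `aG` at `u = 4`
  obtain ⟨eG', Y, heG'd, heG'i, hYd, hYi, hs2⟩ := exists_split_last aG haGd hGs
    (isSemialgebraicFunOn_one hGs) (isSemialgebraicFunOn_A hGs fun _ hx => hx.1)
    (isSemialgebraicFunOn_four hGs) (fun _ _ => by norm_num) (fun x hx => by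
      have h : 3 * x 0 ^ 2 < (1 : ℝ) := hx.2
      have h0 : x 0 ≠ 0 := hx.1
      rw [le_div_iff₀ (by positivity)]
      linarith)
  have h2 : KZ.of eG' - KZ.of eG ∈ KZ.relations :=
    of_sub_of_mem_relations_of_eqOn (by rw [heGd, heG'd]) fun z _ => by
      rw [heG'i, haGi, hai, heGi, hei]
  refine ⟨X, Y, hXd, hXi.trans (heLi.trans hei), hYd, hYi.trans (haGi.trans hai), ?_⟩
  have : KZ.of e - KZ.of a - (KZ.of X - KZ.of Y) = (KZ.of e - KZ.of eL - KZ.of eG)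
      - (KZ.of a - KZ.of aL - KZ.of aG) + (KZ.of eL - KZ.of aL' - KZ.of X) + (KZ.of aL' - KZ.of aL)
      - (KZ.of aG - KZ.of eG' - KZ.of Y) - (KZ.of eG' - KZ.of eG) := by abel
  rw [this]
  exact KZ.relations.sub_mem (KZ.relations.sub_mem (KZ.relations.add_mem (KZ.relations.add_mem
    (KZ.relations.sub_mem hse hsa) hs1) h1) hs2) h2

end Summit.KontsevichZagierPeriods.K2SymbolChains.ClausenPi
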